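import Mathlib
import Summits.AnomalousDissipation.AnomalousDissipation.Theorems.SoloBlindLogNormTail

/-!
# Sourced Duhamel telescoping: the error budget of the monodromy-box engine (solo-blind s80, §24.90(10))

The (MB) certificate engine (work/goertler/mbox) computes the Taylor blocks `M_j` of the leaf
monodromy WITHOUT a validated ODE solver: each block's piecewise Taylor polynomial has an explicit
DEFECT `R_j` (uncancelled high orders, dropped restart radii, generator remainder), and the error
`e_j = Φ_j − Φ̃_j` solves `e_j' = Ã_c e_j + Ã₁ e_{j−1} − R_j`, `e_j(0) = 0`.  With the two-time
log-norm bound `‖Φ_c(t,s)‖ ≤ e^{m(t) − m(s)}` this gives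
`‖e_j(t)‖ ≤ e^{m(t)} ρ_j + ∫₀ᵗ e^{m(t)−m(s)} ‖Ã₁(s)‖ ‖e_{j−1}(s)‖ ds`, `ρ_j = ∫₀ᵀ e^{−m}‖R_j‖`,
and the lemma below telescopes the hierarchy to the closed form used by the engine
(`mboxD.py`, first certified box P = 44 ± 0.9, kit j337575):

  `‖e_j(t)‖ ≤ e^{m(t)} Σ_{i ≤ j} ρ_i F(t)^{j−i} / (j−i)!`,  `F(t) = ∫₀ᵗ ‖Ã₁‖`.

* `iterated_duhamel_sourced` — from `g₀ ≤ ρ₀`, `g_{j+1}(t) ≤ ρ_{j+1} + ∫₀ᵗ a(s) g_j(s) ds`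
  (`a ≥ 0` continuous): `g_j(t) ≤ Σ_{i∈range(j+1)} ρ_i F(t)^{j−i}/(j−i)!`;
* `lognorm_duhamel_sourced` — the telescoped form with the weight `e^{m(t)}`.
-/

open Finset MeasureTheory Set intervalIntegral

namespace Summit.AnomalousDissipation.AnomalousDissipation.Theorems

/-- **Sourced iterated Duhamel bound.**  If `g 0 t ≤ ρ 0` and
`g (j+1) t ≤ ρ (j+1) + ∫₀ᵗ a(s) g j(s) ds` on `[0,T]` with `a ≥ 0` continuous, then
`g j t ≤ Σ_{i ≤ j} ρ i · F(t)^{j-i}/(j-i)!`, `F(t) = ∫₀ᵗ a`. -/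
theorem iterated_duhamel_sourced (g : ℕ → ℝ → ℝ) (ρ : ℕ → ℝ) {a : ℝ → ℝ} {T : ℝ}
    (ha : Continuous a) (ha0 : ∀ t, 0 ≤ a t)
    (hint : ∀ j, ∀ t ∈ Icc (0 : ℝ) T, IntervalIntegrable (fun s => a s * g j s) volume 0 t)
    (h0 : ∀ t ∈ Icc (0 : ℝ) T, g 0 t ≤ ρ 0)
    (hstep : ∀ j, ∀ t ∈ Icc (0 : ℝ) T, g (j + 1) t ≤ ρ (j + 1) + ∫ s in (0 : ℝ)..t, a s * g j s) :
    ∀ j, ∀ t ∈ Icc (0 : ℝ) T,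
      g j t ≤ ∑ i ∈ range (j + 1),
        ρ i * (∫ u in (0 : ℝ)..t, a u) ^ (j - i) / (Nat.factorial (j - i) : ℝ) := by
  have hcontF : Continuous fun s : ℝ => ∫ u in (0 : ℝ)..s, a u := by
    have := (continuous_primitive (fun _ _ => ha.intervalIntegrable _ _) (0 : ℝ) (μ := volume))
    simpa using this
  intro j
  induction j with
  | zero =>
      intro t ht
      simpa using h0 t ht
  | succ j ih =>
      intro t ht
      have ht0 : 0 ≤ t := ht.1
      have htT : t ≤ T := ht.2
      refine (hstep j t ht).trans ?_
      -- the bound for g j, as a function of s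
      set B : ℝ → ℝ := fun s => ∑ i ∈ range (j + 1),
        ρ i * (∫ u in (0 : ℝ)..s, a u) ^ (j - i) / (Nat.factorial (j - i) : ℝ) with hB
      have hBcont : Continuous B := by
        refine continuous_finsetSum _ fun i _ => ?_
        exact (continuous_const.mul (hcontF.pow _)).div_const _
      have hbi : IntervalIntegrable (fun s => a s * B s) volume 0 t :=
        (ha.mul hBcont).intervalIntegrable 0 t
      have hmono : ∫ s in (0 : ℝ)..t, a s * g j s ≤ ∫ s in (0 : ℝ)..t, a s * B s := by
        apply integral_mono_on ht0 (hint j t ht) hbi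
        intro s hs
        exact mul_le_mul_of_nonneg_left (ih s ⟨hs.1, hs.2.trans htT⟩) (ha0 s)
      -- evaluate ∫ a B termwise
      have hterm : ∀ i ∈ range (j + 1),
          ∫ s in (0 : ℝ)..t, a s * (ρ i * (∫ u in (0 : ℝ)..s, a u) ^ (j - i) /
              (Nat.factorial (j - i) : ℝ)) =
            ρ i * (∫ u in (0 : ℝ)..t, a u) ^ (j + 1 - i) / (Nat.factorial (j + 1 - i) : ℝ) := by
        intro i hi
        have hij : i ≤ j := Nat.lt_succ_iff.mp (mem_range.mp hi)
        have hsub : j + 1 - i = (j - i) + 1 := by omega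
        calc ∫ s in (0 : ℝ)..t, a s * (ρ i * (∫ u in (0 : ℝ)..s, a u) ^ (j - i) /
                (Nat.factorial (j - i) : ℝ))
            = ρ i / (Nat.factorial (j - i) : ℝ) *
                ∫ s in (0 : ℝ)..t, a s * (∫ u in (0 : ℝ)..s, a u) ^ (j - i) := by
              rw [← intervalIntegral.integral_const_mul]
              congr 1; funext s; ring
          _ = ρ i / (Nat.factorial (j - i) : ℝ) *
                ((∫ u in (0 : ℝ)..t, a u) ^ (j - i + 1) / ((j - i : ℕ) + 1 : ℝ)) := by
              rw [integral_mul_pow_primitive ha (j - i) t]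
          _ = ρ i * (∫ u in (0 : ℝ)..t, a u) ^ (j + 1 - i) / (Nat.factorial (j + 1 - i) : ℝ) := by
              rw [hsub, Nat.factorial_succ, Nat.cast_mul, Nat.cast_succ]
              have h1 : (Nat.factorial (j - i) : ℝ) ≠ 0 := by positivity
              have h2 : ((j - i : ℕ) : ℝ) + 1 ≠ 0 := by positivity
              field_simp
      have hint_terms : ∀ i ∈ range (j + 1), IntervalIntegrable
          (fun s => a s * (ρ i * (∫ u in (0 : ℝ)..s, a u) ^ (j - i) /
            (Nat.factorial (j - i) : ℝ))) volume 0 t := by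
        intro i _
        exact (ha.mul ((continuous_const.mul (hcontF.pow _)).div_const _)).intervalIntegrable 0 t
      have heval : ∫ s in (0 : ℝ)..t, a s * B s =
          ∑ i ∈ range (j + 1),
            ρ i * (∫ u in (0 : ℝ)..t, a u) ^ (j + 1 - i) / (Nat.factorial (j + 1 - i) : ℝ) := by
        have hmul : (fun s => a s * B s) = fun s => ∑ i ∈ range (j + 1),
            a s * (ρ i * (∫ u in (0 : ℝ)..s, a u) ^ (j - i) / (Nat.factorial (j - i) : ℝ)) := by
          funext s; simp only [hB, Finset.mul_sum]
        rw [hmul, intervalIntegral.integral_finsetSum hint_terms]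
        exact Finset.sum_congr rfl hterm
      -- assemble: ρ (j+1) is the i = j+1 term
      calc ρ (j + 1) + ∫ s in (0 : ℝ)..t, a s * g j s
          ≤ ρ (j + 1) + ∫ s in (0 : ℝ)..t, a s * B s := by linarith
        _ = ∑ i ∈ range (j + 1 + 1),
              ρ i * (∫ u in (0 : ℝ)..t, a u) ^ (j + 1 - i) / (Nat.factorial (j + 1 - i) : ℝ) := by
            rw [heval]
            symm
            rw [Finset.sum_range_succ, Nat.sub_self, pow_zero, Nat.factorial_zero, Nat.cast_one,
              div_one, mul_one]
            ring

/-- **Sourced log-norm telescoping** (the engine's error budget).  If `g 0 t ≤ e^{m(t)} ρ 0` and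
`g (j+1) t ≤ e^{m(t)} ρ (j+1) + ∫₀ᵗ e^{m(t) − m(s)} a(s) g j(s) ds` on `[0,T]`, then
`g j t ≤ e^{m(t)} Σ_{i ≤ j} ρ i F(t)^{j−i}/(j−i)!`. -/
theorem lognorm_duhamel_sourced (g : ℕ → ℝ → ℝ) (ρ : ℕ → ℝ) (m : ℝ → ℝ) {a : ℝ → ℝ} {T : ℝ}
    (ha : Continuous a) (ha0 : ∀ t, 0 ≤ a t)
    (hint : ∀ j, ∀ t ∈ Icc (0 : ℝ) T,
      IntervalIntegrable (fun s => a s * (Real.exp (-m s) * g j s)) volume 0 t)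
    (h0 : ∀ t ∈ Icc (0 : ℝ) T, g 0 t ≤ Real.exp (m t) * ρ 0)
    (hstep : ∀ j, ∀ t ∈ Icc (0 : ℝ) T,
      g (j + 1) t ≤ Real.exp (m t) * ρ (j + 1) +
        ∫ s in (0 : ℝ)..t, Real.exp (m t - m s) * a s * g j s) :
    ∀ j, ∀ t ∈ Icc (0 : ℝ) T,
      g j t ≤ Real.exp (m t) * ∑ i ∈ range (j + 1),
        ρ i * (∫ u in (0 : ℝ)..t, a u) ^ (j - i) / (Nat.factorial (j - i) : ℝ) := by
  set h : ℕ → ℝ → ℝ := fun j t => Real.exp (-m t) * g j t with hh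
  have hpos : ∀ t, 0 < Real.exp (m t) := fun t => Real.exp_pos _
  have hinv : ∀ t, Real.exp (-m t) = (Real.exp (m t))⁻¹ := fun t => Real.exp_neg _
  have h0' : ∀ t ∈ Icc (0 : ℝ) T, h 0 t ≤ ρ 0 := by
    intro t ht
    have := mul_le_mul_of_nonneg_left (h0 t ht) (inv_nonneg.mpr (hpos t).le)
    rw [← mul_assoc, inv_mul_cancel₀ (hpos t).ne', one_mul] at this
    simpa [hh, hinv] using this
  have hstep' : ∀ j, ∀ t ∈ Icc (0 : ℝ) T,
      h (j + 1) t ≤ ρ (j + 1) + ∫ s in (0 : ℝ)..t, a s * h j s := by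
    intro j t ht
    have hs := hstep j t ht
    have hrw : (fun s => Real.exp (m t - m s) * a s * g j s) =
        fun s => Real.exp (m t) * (a s * (Real.exp (-m s) * g j s)) := by
      funext s; rw [Real.exp_sub, Real.exp_neg]; ring
    rw [hrw, intervalIntegral.integral_const_mul, ← mul_add] at hs
    have := mul_le_mul_of_nonneg_left hs (inv_nonneg.mpr (hpos t).le)
    rw [← mul_assoc, inv_mul_cancel₀ (hpos t).ne', one_mul] at this
    simpa [hh, hinv] using this
  have key := iterated_duhamel_sourced h ρ ha ha0 hint h0' hstep'
  intro j t ht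
  have hk := key j t ht
  simp only [hh] at hk
  have := mul_le_mul_of_nonneg_left hk (hpos t).le
  rwa [← mul_assoc, hinv, mul_inv_cancel₀ (hpos t).ne', one_mul] at this

end Summit.AnomalousDissipation.AnomalousDissipation.Theorems
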